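import Mathlib
import Summits.PneNP.PneNP.Theorems.SymmetryBudgetWindowBarrierHardToIdentify
import Summits.PneNP.PneNP.Theorems.SymmetryBudgetWindowBarrierTwinIsoCapstone

/-!
# `WindowBarrier ⟸ {Babai–Luks 1983, (★) CoreFooling}` — registered stub `windowBarrier_of_coreFooling`

Crux `SymmetryBudget.WindowBarrier` (item stmt-PneNP-2145), line `bijection-gauge-twin-iso`: the old
line's capstone (crux ⟸ {BL83, (★)}) as ONE tree theorem, by composing two landed theorems —
`hardToIdentify_of_coreFooling` ((★) ⟹ HardToIdentify, `SymmetryBudgetWindowBarrierHardToIdentify.lean`)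
and `windowBarrier_of_hardToIdentify` (BL83 → HardToIdentify → WindowBarrier,
`SymmetryBudgetWindowBarrierTwinIsoCapstone.lean`).  (★) CoreFooling: for every `d`, infinitely often
two non-isomorphic `g`-vertex graphs agree on every `Sym(Fin g)`-symmetric `tcBasis`-circuit with at
most `2^{dg}` gates.  Both open parts are HYPOTHESES; no `sorry`, no new axiom, no definition.
-/

-- `Summit.PneNP.PneNP.…` duplicates `PneNP` BY DESIGN (single-problem summit, D-0017).
set_option linter.dupNamespace false

namespace Summit.PneNP.PneNP.Theorems

open Literature.Computability.Complexity Filter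
open scoped Classical

/-- **`WindowBarrier` from Babai–Luks canonical forms and (★) CoreFooling** (registered stub
`windowBarrier_of_coreFooling` of crux stmt-PneNP-2145): `windowBarrier_of_hardToIdentify` applied to
`hardToIdentify_of_coreFooling`.  So in the tree the crux is implied by {the one literature debt
`babaiLuks1983_canonicalForm`, the square-symmetric fooling conjecture (★)}. -/
theorem windowBarrier_of_coreFooling :
    babaiLuks1983_canonicalForm →
    (∀ d : ℕ, ∃ᶠ g in atTop, ∃ G₁ G₂ : SimpleGraph (Fin g), ¬ Nonempty (G₁ ≃g G₂) ∧
      ∀ C : Circuit (Fin g × Fin g), C.IsOver tcBasis → C.size ≤ 2 ^ (d * g) →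
        C.IsSymmetricUnder Set.univ →
          C.eval (fun p : Fin g × Fin g => decide (G₁.Adj p.1 p.2)) =
            C.eval (fun p : Fin g × Fin g => decide (G₂.Adj p.1 p.2))) →
    Summit.PneNP.PneNP.Theses.SymmetryBudget.WindowBarrier :=
  fun hBL hcore => windowBarrier_of_hardToIdentify hBL (hardToIdentify_of_coreFooling hcore)

end Summit.PneNP.PneNP.Theorems
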